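import Summits.KontsevichZagierPeriods.Zeta5Search.Barrier.ConeGammaEnvelopeFirstOrder

/-!
# ζ(5) search — BARRIER: THE ENVELOPE BOUND WITHOUT CALCULUS — concavity at the centre (second order) and the
# ONE-SIDED first-order theorem

HONEST FRAMING (cell `pub-zeta5`): systematic search; no irrationality claim unless kernel-certified. Theorems only. MODEL
objects under Brown–Zudilin's (28)+(30) ((28) observed, not proved): BZ's growth functional at critical points, cert-2
g39's value function `Envelope.valueV` and checker `Envelope.concCheck / envUpperCheck`. Nothing about any γ, the cone's
supremum (C2 OPEN), S-E (CONJECTURED), (TD_A) or `ζ(5)`; no number of record moves; records in print UNMOVED. Theory seat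
cert-2 g39 (item «THE ENVELOPE BOUND FOR C₁ WITHOUT CALCULUS», part 3c).

THE SECOND BRACKET WITHOUT A BUDGET. `V(c, w) − V(c, w_c) − ∇V(c, w_c)·(w − w_c) = Σ_k σ_k·[xlnx L_k(w) − xlnx L_k(w_c) −
ΔL_k·log|L_k(w_c)|]`, and each bracket is `a·ψ(b/a)`, `ψ(u) = u log u − u + 1 ∈ [(u−1)²/(2 max(1,u)), (u−1)²/(2 min(1,u))]`
(`psi_quad_bounds` — two monotonicity facts, the only calculus in the item), so `σ_k·[…] ≤ ρ_k·ΔL_k²` with the weight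
`ρ_k` of `formRho` (`= 1/(2m_k)` or `−1/(2M_k)` according to the sign of `σ_k·L_k`). The decoupled form
`Σ_k ρ_k (β_k ΔX + β′_k ΔY)²` is NEGATIVE SEMIDEFINITE by the exact rational check `concCheck`; with `∇V(c, w_c) = 0` at a
critical point this gives `V(c, w) ≤ V(c, w_c)` for every `w` in the tube — the top critical point IS the maximum of
`V(c, ·)` on the tube — and hence the ONE-SIDED first-order theorem
`V(t, w(t)) − V(c, w_c) ≤ Σ_i (t_i − c_i)·v_i`, `v ∈ hull`, with NO tangent-difference budget.

* `formRho_sound`, `quadAcc_sound`, `nsd_of_concCheck`, **`value_le_centre_of_concCheck`**;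
* **`critical_value_first_order_upper`**, `critical_value_upper_box` (`envUpperCheck … p q ⇒ V(t, w) − V(c, w_c) ≤ p/q`).
-/

noncomputable section

open Finset Set
open Literature.Analysis.ValidatedNumerics.NumericsMP

namespace Summit.KontsevichZagierPeriods.Zeta5Search.Barrier.ConeGamma

namespace Envelope

open LemmaFBox (SC SC_pos KT coef featVal minNum maxNum sum8 lnNat box centre centre_mem abs_sub_centre_le abs_le_of_mem
  minNum_le le_maxNum cast_toNat_of_pos getD_map_range featVal_sub_eq_sum sum8_eq_sum mem_log_of_range)
open LemmaFWinBox (getI addHull zeroHull hull_zero hull_addHull getI_addHull boxOK8 boxOK8_spec centrePt)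
open LemmaFWin (zI mem_zI)

/-! ### One form: the curvature weight -/

/-- **Soundness of the curvature weight**: with `formRho … f = some ρ`, for two points of the tube at the centre
`σ·(xlnx L(c; X, Y) − xlnx L(c; X_c, Y_c) − ΔL·log|L(c; X_c, Y_c)|) ≤ ρ·ΔL²`. -/
theorem formRho_sound {D T0 : ℕ} (hD : 0 < D) (hT0 : 0 < T0 / 2) (hT2 : T0 % 2 = 0) {lo hi : List ℕ} {tb : Tube}
    {f : EForm} {ρ : ℚ} (h : formRho D T0 lo hi tb f = some ρ) {X Y Xc Yc : ℝ}
    (hP : (X, Y) ∈ tube D T0 tb) (hPc : (Xc, Yc) ∈ tube D T0 tb) :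
    (f.sg : ℝ) * (xlnx (formVal f (centre D lo hi) X Y) - xlnx (formVal f (centre D lo hi) Xc Yc)
        - (formVal f (centre D lo hi) X Y - formVal f (centre D lo hi) Xc Yc)
          * Real.log (|formVal f (centre D lo hi) Xc Yc|))
      ≤ ((ρ : ℚ) : ℝ) * (formVal f (centre D lo hi) X Y - formVal f (centre D lo hi) Xc Yc) ^ 2 := by
  -- the degenerate centre box has the same scale
  have hT0e : 2 * (T0 / 2) = T0 := by omega
  have eQ : (2 * ((2 * D : ℕ) : ℝ) * ((T0 / 2 : ℕ) : ℝ)) = 2 * D * T0 := by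
    have : ((2 * (T0 / 2) : ℕ) : ℝ) = (T0 : ℝ) := by exact_mod_cast hT0e
    push_cast at this ⊢; nlinarith [this]
  have hQ : (0 : ℝ) < 2 * D * T0 := by
    have : 0 < T0 := by omega
    positivity
  have hcc := centre_mem_cbox hD lo hi
  have ctube : ∀ ⦃A B : ℝ⦄, (A, B) ∈ tube D T0 tb → (A, B) ∈ tube (2 * D) (T0 / 2) tb := by
    intro A B hAB
    simp only [tube, Set.mem_setOf_eq] at hAB ⊢
    rw [eQ]; exact hAB
  have r1 := formVal_range (D := 2 * D) (T0 := T0 / 2) f hcc (ctube hP)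
  have r2 := formVal_range (D := 2 * D) (T0 := T0 / 2) f hcc (ctube hPc)
  rw [eQ] at r1 r2
  set L := formVal f (centre D lo hi) X Y with hL
  set L' := formVal f (centre D lo hi) Xc Yc with hL'
  -- unpack formRho
  unfold formRho at h
  simp only at h
  set A := rangeLo (T0 / 2) (centrePt lo hi) (centrePt lo hi) tb f with hA
  set B := rangeHi (T0 / 2) (centrePt lo hi) (centrePt lo hi) tb f with hB
  by_cases hsgn : 0 < A ∨ B < 0
  · rw [if_pos hsgn] at h
    by_cases hs1 : f.sg = 1
    · rw [if_pos hs1] at h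
      simp only [Option.some.injEq] at h
      subst h
      rw [hs1]
      push_cast
      rw [one_mul]
      rcases hsgn with hApos | hBneg
      · -- positive form: ρ = Q/(2A) = 1/(2m), m = A/Q
        have hAr : (0 : ℝ) < A := by exact_mod_cast hApos
        set m : ℝ := (A : ℝ) / (2 * D * T0) with hm
        set M : ℝ := (B : ℝ) / (2 * D * T0) with hM
        have hm0 : 0 < m := div_pos hAr hQ
        have b1 : m ≤ L' := by rw [hm, div_le_iff₀ hQ]; exact r2.1
        have b2 : L' ≤ M := by rw [hM, le_div_iff₀ hQ]; exact r2.2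
        have b3 : m ≤ L := by rw [hm, div_le_iff₀ hQ]; exact r1.1
        have b4 : L ≤ M := by rw [hM, le_div_iff₀ hQ]; exact r1.2
        have := (xlnx_tangent_quad_pos hm0 b1 b2 b3 b4).2
        refine this.trans (le_of_eq ?_)
        rw [hm]; field_simp
      · -- negative form with σ = 1: ρ = Q/(2A) = −1/(2M), M = −A/Q
        have hBr : (B : ℝ) < 0 := by exact_mod_cast hBneg
        set m : ℝ := -(B : ℝ) / (2 * D * T0) with hm
        set M : ℝ := -(A : ℝ) / (2 * D * T0) with hM
        have hm0 : 0 < m := div_pos (by linarith) hQ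
        have b1 : m ≤ -L' := by rw [hm, div_le_iff₀ hQ]; linarith [r2.2]
        have b2 : -L' ≤ M := by rw [hM, le_div_iff₀ hQ]; linarith [r2.1]
        have b3 : m ≤ -L := by rw [hm, div_le_iff₀ hQ]; linarith [r1.2]
        have b4 : -L ≤ M := by rw [hM, le_div_iff₀ hQ]; linarith [r1.1]
        have hM0 : 0 < M := hm0.trans_le (b1.trans b2)
        have hAneg : (A : ℝ) < 0 := by
          have : -(A : ℝ) / (2 * D * T0) > 0 := hM0; rw [gt_iff_lt, div_pos_iff] at this
          rcases this with ⟨h1, _⟩ | ⟨_, h2⟩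
          · linarith
          · linarith
        have := (xlnx_tangent_quad_neg hm0 b1 b2 b3 b4).1
        -- (L−L')²/(2M) ≤ −T  ⇒  T ≤ −(L−L')²/(2M) = Q/(2A)·(L−L')²
        have e : -((L - L') ^ 2 / (2 * M)) = (2 * D * T0 : ℝ) / (2 * A) * (L - L') ^ 2 := by
          rw [hM]; field_simp
        linarith [e]
    · rw [if_neg hs1] at h
      by_cases hs2 : f.sg = -1
      · rw [if_pos hs2] at h
        simp only [Option.some.injEq] at h
        subst h
        rw [hs2]
        push_cast
        rcases hsgn with hApos | hBneg
        · -- positive form, σ = −1: ρ = −Q/(2B) = −1/(2M)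
          have hAr : (0 : ℝ) < A := by exact_mod_cast hApos
          set m : ℝ := (A : ℝ) / (2 * D * T0) with hm
          set M : ℝ := (B : ℝ) / (2 * D * T0) with hM
          have hm0 : 0 < m := div_pos hAr hQ
          have b1 : m ≤ L' := by rw [hm, div_le_iff₀ hQ]; exact r2.1
          have b2 : L' ≤ M := by rw [hM, le_div_iff₀ hQ]; exact r2.2
          have b3 : m ≤ L := by rw [hm, div_le_iff₀ hQ]; exact r1.1
          have b4 : L ≤ M := by rw [hM, le_div_iff₀ hQ]; exact r1.2
          have hM0 : 0 < M := hm0.trans_le (b1.trans b2)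
          have hBpos : (0 : ℝ) < B := by
            have : (B : ℝ) / (2 * D * T0) > 0 := hM0; rw [gt_iff_lt, div_pos_iff] at this
            rcases this with ⟨h1, _⟩ | ⟨_, h2⟩
            · exact h1
            · linarith
          have := (xlnx_tangent_quad_pos hm0 b1 b2 b3 b4).1
          have e : -((L - L') ^ 2 / (2 * M)) = -(2 * D * T0 : ℝ) / (2 * B) * (L - L') ^ 2 := by
            rw [hM]; field_simp
          linarith [e]
        · -- negative form, σ = −1: ρ = −Q/(2B) = 1/(2m), m = −B/Q
          have hBr : (B : ℝ) < 0 := by exact_mod_cast hBneg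
          set m : ℝ := -(B : ℝ) / (2 * D * T0) with hm
          set M : ℝ := -(A : ℝ) / (2 * D * T0) with hM
          have hm0 : 0 < m := div_pos (by linarith) hQ
          have b1 : m ≤ -L' := by rw [hm, div_le_iff₀ hQ]; linarith [r2.2]
          have b2 : -L' ≤ M := by rw [hM, le_div_iff₀ hQ]; linarith [r2.1]
          have b3 : m ≤ -L := by rw [hm, div_le_iff₀ hQ]; linarith [r1.2]
          have b4 : -L ≤ M := by rw [hM, le_div_iff₀ hQ]; linarith [r1.1]
          have := (xlnx_tangent_quad_neg hm0 b1 b2 b3 b4).2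
          have e : (L - L') ^ 2 / (2 * m) = -(2 * D * T0 : ℝ) / (2 * B) * (L - L') ^ 2 := by
            rw [hm]; field_simp
          linarith [e]
      · rw [if_neg hs2] at h; simp at h
  · rw [if_neg hsgn] at h; simp at h

/-! ### The list recursion and negative semidefiniteness -/

/-- **Soundness of the quadratic accumulator**: the signed tangent differences of the forms of `F` at the centre sum to
at most `A ΔX² + 2B ΔXΔY + C ΔY²`. -/
theorem quadAcc_sound {D T0 : ℕ} (hD : 0 < D) (hT0 : 0 < T0 / 2) (hT2 : T0 % 2 = 0) {lo hi : List ℕ} {tb : Tube}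
    {X Y Xc Yc : ℝ} (hP : (X, Y) ∈ tube D T0 tb) (hPc : (Xc, Yc) ∈ tube D T0 tb) :
    ∀ (F : List EForm) {A B C : ℚ}, quadAcc D T0 lo hi tb F = some (A, B, C) →
      valF F (centre D lo hi) X Y - valF F (centre D lo hi) Xc Yc
          - ((X - Xc) * gxF F (centre D lo hi) Xc Yc + (Y - Yc) * gyF F (centre D lo hi) Xc Yc)
        ≤ ((A : ℚ) : ℝ) * (X - Xc) ^ 2 + 2 * ((B : ℚ) : ℝ) * ((X - Xc) * (Y - Yc)) + ((C : ℚ) : ℝ) * (Y - Yc) ^ 2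
  | [], A, B, C, h => by
    simp only [quadAcc, Option.some.injEq, Prod.mk.injEq] at h
    obtain ⟨rfl, rfl, rfl⟩ := h
    simp [valF_nil, gxF_nil, gyF_nil]
  | f :: F, A, B, C, h => by
    simp only [quadAcc] at h
    split at h
    swap
    · simp at h
    rename_i A' B' C' ρ hF hρ
    simp only [Option.some.injEq, Prod.mk.injEq] at h
    obtain ⟨rfl, rfl, rfl⟩ := h
    have IH := quadAcc_sound hD hT0 hT2 hP hPc F hF
    have hf := formRho_sound hD hT0 hT2 hρ hP hPc
    set L := formVal f (centre D lo hi) X Y with hL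
    set L' := formVal f (centre D lo hi) Xc Yc with hL'
    have eL : L - L' = (f.bx : ℝ) * (X - Xc) + (f.bY : ℝ) * (Y - Yc) := by rw [hL, hL', formVal_sub_w]
    have esplit : valF (f :: F) (centre D lo hi) X Y - valF (f :: F) (centre D lo hi) Xc Yc
        - ((X - Xc) * gxF (f :: F) (centre D lo hi) Xc Yc + (Y - Yc) * gyF (f :: F) (centre D lo hi) Xc Yc)
        = (f.sg : ℝ) * (xlnx L - xlnx L' - (L - L') * Real.log (|L'|))
          + (valF F (centre D lo hi) X Y - valF F (centre D lo hi) Xc Yc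
            - ((X - Xc) * gxF F (centre D lo hi) Xc Yc + (Y - Yc) * gyF F (centre D lo hi) Xc Yc)) := by
      rw [valF_cons, valF_cons, gxF_cons, gyF_cons, eL]; ring
    rw [esplit]
    have := add_le_add hf IH
    refine this.trans (le_of_eq ?_)
    rw [eL]
    push_cast
    ring

/-- **A 2×2 negative-semidefiniteness criterion**: `A ≤ 0`, `C ≤ 0`, `B² ≤ AC` ⇒ `A x² + 2B xy + C y² ≤ 0`. -/
theorem quad_nonpos {A B C : ℝ} (hA : A ≤ 0) (hC : C ≤ 0) (hAC : B * B ≤ A * C) (x y : ℝ) :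
    A * x ^ 2 + 2 * B * (x * y) + C * y ^ 2 ≤ 0 := by
  rcases hA.lt_or_eq with hAn | hA0
  · -- A < 0: A·(form) = (Ax + By)² + (AC − B²)y² ≥ 0
    have key : A * (A * x ^ 2 + 2 * B * (x * y) + C * y ^ 2) = (A * x + B * y) ^ 2 + (A * C - B * B) * y ^ 2 := by ring
    have hnn : 0 ≤ A * (A * x ^ 2 + 2 * B * (x * y) + C * y ^ 2) := by
      rw [key]; nlinarith [sq_nonneg (A * x + B * y), sq_nonneg y]
    nlinarith
  · -- A = 0 ⇒ B = 0
    have hB : B = 0 := by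
      have : B * B ≤ 0 := by rw [hA0, zero_mul] at hAC; exact hAC
      nlinarith [sq_nonneg B]
    rw [hA0, hB]
    nlinarith [sq_nonneg y]

/-- **The centre's critical point maximises `V(c, ·)` on the tube** (given `concCheck`): for `(X, Y)`, `(X_c, Y_c)` in the
tube with both log-forms vanishing at `(c; X_c, Y_c)`, `V(c; X, Y) ≤ V(c; X_c, Y_c)`. -/
theorem value_le_centre_of_concCheck {D T0 : ℕ} (hD : 0 < D) (hT0 : 0 < T0 / 2) (hT2 : T0 % 2 = 0) {lo hi : List ℕ}
    {tb : Tube} (hcc : concCheck D T0 lo hi tb = true) {X Y Xc Yc : ℝ} (hP : (X, Y) ∈ tube D T0 tb)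
    (hPc : (Xc, Yc) ∈ tube D T0 tb) (hgx : gxF vforms (centre D lo hi) Xc Yc = 0)
    (hgy : gyF vforms (centre D lo hi) Xc Yc = 0) :
    valueV (centre D lo hi) X Y ≤ valueV (centre D lo hi) Xc Yc := by
  unfold concCheck at hcc
  split at hcc
  swap
  · simp at hcc
  rename_i A B C hq
  simp only [Bool.and_eq_true, decide_eq_true_eq] at hcc
  obtain ⟨⟨hA, hC⟩, hAC⟩ := hcc
  have h := quadAcc_sound hD hT0 hT2 hP hPc (lo := lo) (hi := hi) vforms hq
  rw [hgx, hgy, mul_zero, mul_zero, add_zero, sub_zero] at h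
  have hA' : ((A : ℚ) : ℝ) ≤ 0 := by exact_mod_cast hA
  have hC' : ((C : ℚ) : ℝ) ≤ 0 := by exact_mod_cast hC
  have hAC' : ((B : ℚ) : ℝ) * ((B : ℚ) : ℝ) ≤ ((A : ℚ) : ℝ) * ((C : ℚ) : ℝ) := by exact_mod_cast hAC
  have := quad_nonpos hA' hC' hAC' (X - Xc) (Y - Yc)
  unfold valueV
  linarith

/-! ### The one-sided first-order theorem -/

/-- **ONE-SIDED FIRST-ORDER THEOREM (no tangent-difference budget).** `envOK`, `concCheck` and the envelope summary: for a
critical point `(X, Y)` of the box direction `t` and a critical point `(X_c, Y_c)` of the centre direction, both in the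
tube, `∃ v ∈ hull, growthLogR(t-point) − growthLogR(c-point) ≤ Σ_i (t_i − c_i)·v_i`. -/
theorem critical_value_first_order_upper {D T0 : ℕ} {lo hi : List ℕ} {tb : Tube} {dX dY : ℕ}
    (hok : envOK D T0 lo hi tb = true) (hcc : concCheck D T0 lo hi tb = true)
    {g : List MI} {e : ℤ} (hs : envSummary D T0 lo hi tb dX dY = some (g, e))
    {t : Fin 8 → ℝ} (ht : t ∈ box D lo hi) {X Y : ℝ} (hXY : (X, Y) ∈ tube D T0 tb)
    (hc : IsCritical (aOfS t) (X + t 6) (Y + t 6))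
    {Xc Yc : ℝ} (hXYc : (Xc, Yc) ∈ tube D T0 tb)
    (hcrit : IsCritical (aOfS (centre D lo hi)) (Xc + centre D lo hi 6) (Yc + centre D lo hi 6)) :
    ∃ v : Fin 8 → ℝ, (∀ i : Fin 8, MI.mem SC (v i) (getI g i)) ∧
      growthLogR (pR (aOfS t)) (qR (aOfS t)) (X + t 6) (Y + t 6)
          - growthLogR (pR (aOfS (centre D lo hi))) (qR (aOfS (centre D lo hi))) (Xc + centre D lo hi 6)
              (Yc + centre D lo hi 6)
        ≤ ∑ i : Fin 8, (t i - centre D lo hi i) * v i := by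
  obtain ⟨hD, ⟨hT0, hT2⟩, _, _, hle, _⟩ := envOK_spec hok
  have hle' : ∀ i : Fin 8, lo.getD i 0 ≤ hi.getD i 0 := fun i => (hle i).1
  set c := centre D lo hi with hcdef
  have hcmem : c ∈ box D lo hi := centre_mem hD hle'
  obtain ⟨IH1, _, IH3⟩ := envAcc_sound hD hT0 hT2 hle' (tb := tb) (dX := dX) (dY := dY) vforms hs
  have f0mem : (⟨1, [0,0,0,0,0,0,1,0], 1, 0⟩ : EForm) ∈ vforms := by simp [vforms]
  have f1mem : (⟨1, [0,0,0,0,0,0,1,0], 0, 1⟩ : EForm) ∈ vforms := by simp [vforms]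
  have ex : ∀ (u : Fin 8 → ℝ) (P R : ℝ), formVal ⟨1, [0,0,0,0,0,0,1,0], 1, 0⟩ u P R = P + u 6 := by
    intro u P R; simp [formVal, featVal, coef, Fin.sum_univ_eight]; ring
  have ey : ∀ (u : Fin 8 → ℝ) (P R : ℝ), formVal ⟨1, [0,0,0,0,0,0,1,0], 0, 1⟩ u P R = R + u 6 := by
    intro u P R; simp [formVal, featVal, coef, Fin.sum_univ_eight]; ring
  have hx : X + t 6 ≠ 0 := by rw [← ex t X Y]; exact IH3 _ f0mem ht hXY
  have hy : Y + t 6 ≠ 0 := by rw [← ey t X Y]; exact IH3 _ f1mem ht hXY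
  have hxc : Xc + c 6 ≠ 0 := by rw [← ex c Xc Yc]; exact IH3 _ f0mem hcmem hXYc
  have hyc : Yc + c 6 ≠ 0 := by rw [← ey c Xc Yc]; exact IH3 _ f1mem hcmem hXYc
  have hopen := (openBox_of_envOK hok ht).2
  have hopenc := (openBox_of_envOK hok hcmem).2
  rw [growthLogR_eq_valueV hopen hc hx hy, growthLogR_eq_valueV hopenc hcrit hxc hyc]
  obtain ⟨gx0, gy0⟩ := gradXY_eq_zero_of_isCritical hcrit hxc hyc
  obtain ⟨v, hv, e1⟩ := IH1 hXY t ht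
  have e2 := value_le_centre_of_concCheck hD hT0 hT2 hcc hXY hXYc gx0 gy0
  refine ⟨v, hv, ?_⟩
  have : valueV t X Y - valueV c X Y = ∑ i : Fin 8, (t i - c i) * v i := by unfold valueV; exact e1
  linarith

/-- **The one-sided box form.** `envUpperCheck … p q = true` ⇒ `growthLogR(t-point) − growthLogR(c-point) ≤ p/q`. -/
theorem critical_value_upper_box {D T0 : ℕ} {lo hi : List ℕ} {tb : Tube} {p : ℤ} {q : ℕ}
    (hchk : envUpperCheck D T0 lo hi tb p q = true)
    {t : Fin 8 → ℝ} (ht : t ∈ box D lo hi) {X Y : ℝ} (hXY : (X, Y) ∈ tube D T0 tb)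
    (hc : IsCritical (aOfS t) (X + t 6) (Y + t 6))
    {Xc Yc : ℝ} (hXYc : (Xc, Yc) ∈ tube D T0 tb)
    (hcrit : IsCritical (aOfS (centre D lo hi)) (Xc + centre D lo hi 6) (Yc + centre D lo hi 6)) :
    growthLogR (pR (aOfS t)) (qR (aOfS t)) (X + t 6) (Y + t 6)
        - growthLogR (pR (aOfS (centre D lo hi))) (qR (aOfS (centre D lo hi))) (Xc + centre D lo hi 6)
            (Yc + centre D lo hi 6) ≤ (p : ℝ) / q := by
  unfold envUpperCheck at hchk
  simp only [Bool.and_eq_true, decide_eq_true_eq] at hchk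
  obtain ⟨⟨⟨hok, hcc⟩, hq⟩, hsum⟩ := hchk
  split at hsum
  swap
  · simp at hsum
  rename_i g e hs
  rw [decide_eq_true_eq] at hsum
  obtain ⟨hD, _, _, _, hle, _⟩ := envOK_spec hok
  obtain ⟨v, hv, hfo⟩ := critical_value_first_order_upper hok hcc hs ht hXY hc hXYc hcrit
  have hS : (0 : ℝ) < SC := by exact_mod_cast SC_pos
  have hD' : (0 : ℝ) < D := by exact_mod_cast hD
  have hq' : (0 : ℝ) < q := by exact_mod_cast hq
  have hterm : ∀ i : Fin 8, (t i - centre D lo hi i) * v i ≤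
      (((hi.getD i 0 : ℕ) : ℝ) - ((lo.getD i 0 : ℕ) : ℝ)) / (2 * D) * (((max |(getI g i).lo| |(getI g i).hi| : ℤ) : ℝ) / SC) := by
    intro i
    refine (le_abs_self _).trans ?_
    rw [abs_mul]
    refine mul_le_mul (abs_sub_centre_le hD ht i) (abs_le_of_mem (hv i)) (abs_nonneg _) ?_
    have : ((lo.getD i 0 : ℕ) : ℝ) ≤ ((hi.getD i 0 : ℕ) : ℝ) := by exact_mod_cast (hle i).1
    exact div_nonneg (by linarith) (by positivity)
  set R : ℤ := sum8 fun i => (((hi.getD i 0 : ℕ) : ℤ) - ((lo.getD i 0 : ℕ) : ℤ)) * max |(getI g i).lo| |(getI g i).hi| with hR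
  have hslack : ∑ i : Fin 8, (t i - centre D lo hi i) * v i ≤ (R : ℝ) / (2 * D * SC) := by
    refine (Finset.sum_le_sum fun i _ => hterm i).trans (le_of_eq ?_)
    rw [hR, sum8_eq_sum]; push_cast
    rw [Finset.sum_div]
    refine Finset.sum_congr rfl fun i _ => ?_
    field_simp
  have hI : ((R * (q : ℤ) : ℤ) : ℝ) ≤ ((p * (2 * D) * (SC : ℤ) : ℤ) : ℝ) := by exact_mod_cast hsum
  push_cast at hI
  have key : (R : ℝ) / (2 * D * SC) ≤ (p : ℝ) / q := by
    rw [div_le_div_iff₀ (by positivity) hq']; nlinarith [hI]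
  linarith

end Envelope

end Summit.KontsevichZagierPeriods.Zeta5Search.Barrier.ConeGamma

end
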